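import Summits.ResolutionOfSingularities.ResolutionOfSingularities.Theorems.PAlterationAssemblyLevelModel
import Summits.ResolutionOfSingularities.ResolutionOfSingularities.Theses.PAlteration
import HarnessLib

/-!
# `PAlteration.Assembly` (stmt-ResolutionOfSingularities-0553) — PROVED, for every ground field

Route `ResolutionOfSingularities/pAlteration`, item `Assembly` (stmt-0553, rank 1):
`(∀ p prime, PIAlt_p ∧ PICover_p) → ResolutionOfSingularities`, with NO `[k : k^p] < ∞`
hypothesis (the Frobenius argument at the level of `X` itself — Temkin 2013, Rem. 1.3.5 (i) —
needs F-finiteness; it is bypassed here).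

**Theorem B** (`hasResolution_of_thesis`): fix a prime `p` and assume (PIAlt_p), (PICover_p).
Then every integral separated scheme `X` of finite type over ANY field `k` of characteristic `p`
has a resolution. Proof: by `exists_level_model` there are a full Frobenius level
`k_n ⊆ k^{p^{-∞}}`, an integral regular `R_n` and a proper surjective
`ρ_n : R_n → X_n = Spec k_n ×_k X`, birational onto its image `S_n` (obtained by resolving over
the perfect closure with Theorem A and descending). The relative Frobenius `ψ : X → X_n`
(`exists_relFrobenius`) is finite, radicial and surjective and factors through `S_n` (the ideal
of `S_n` is nilpotent and `X` is reduced). The reduced fibre product `Z = (X ×_{S_n} R_n)_red` is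
integral and finite radicial surjective over the regular `R_n`, so (PICover) resolves `Z`; and
`Z → X` is proper and birational (base change of the birational `R_n → S_n` along the universal
homeomorphism `ψ`, then the reduction, an isomorphism over the reduced open where the base change
is an isomorphism).

**The item** (`resolutionOfSingularities_of_palterationThesis`, formerly `assembly_proof`):
`PalterationThesis → ResolutionOfSingularities`; for a prime `p` and a field `k` of characteristic
`p`, reduced → integral by the route's `DescentReducedToIntegral_holds`, integral by Theorem B.
(Full-build repair 2026-08-16: the route decl `Assembly` was dropped by the multi-assembly lint; its
hypothesis was the body of `PalterationThesis` verbatim, so the theorem is restated by name and the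
old name kept as a deprecated alias.)
-/

-- single-problem summit: the doubled namespace component `ResolutionOfSingularities` is forced
set_option linter.dupNamespace false

noncomputable section

open CategoryTheory CategoryTheory.Limits AlgebraicGeometry TopologicalSpace Topology

open Literature.AlgebraicGeometry.Resolution Literature.AlgebraicGeometry.Motives Scheme.IdealSheafData

namespace Summit.ResolutionOfSingularities.ResolutionOfSingularities.Theorems

-- as in Mathlib's pullback API for schemes
set_option backward.isDefEq.respectTransparency false in
/-- **Theorem B.** For a prime `p`, (PIAlt_p) and (PICover_p) imply resolution of singularities
of every integral separated scheme of finite type over every field of characteristic `p`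
(see the module docstring). [folklore] -/
theorem hasResolution_of_thesis (p : ℕ) [Fact p.Prime]
    (hPI : ∀ (k : Type) [Field k] [CharP k p] (X : Scheme.{0}) (f : X ⟶ Spec (.of k)),
      IsSeparated f → LocallyOfFiniteType f → QuasiCompact f → IsIntegral X →
      ∃ (X' : Scheme.{0}) (g : X' ⟶ X), IsProper g ∧ IsIntegral X' ∧ Scheme.IsRegular X' ∧
        Function.Surjective g.base ∧ ∃ U : X.Opens, Dense (U : Set X) ∧ IsFinite (g ∣_ U) ∧
        UniversallyInjective (g ∣_ U))
    (hPC : ∀ (k : Type) [Field k] [CharP k p] (Y X : Scheme.{0}) (f : Y ⟶ Spec (.of k))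
      (g : X ⟶ Y), IsSeparated f → LocallyOfFiniteType f → QuasiCompact f → IsIntegral Y →
      Scheme.IsRegular Y → IsIntegral X → IsFinite g → UniversallyInjective g →
      Function.Surjective g.base → Scheme.HasResolution X)
    {k : Type} [Field k] [CharP k p] {X : Scheme.{0}} (f : X ⟶ Spec (.of k))
    [IsSeparated f] [LocallyOfFiniteType f] [QuasiCompact f] [IsIntegral X] :
    Scheme.HasResolution X := by
  obtain ⟨n, Rn, ρn, hRnint, hRnreg, hρnP, hρnsurj, hbir⟩ := exists_level_model p hPI hPC f
  haveI := hRnint; haveI := hρnP; haveI := hρnsurj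
  -- the level
  let L := Subfield.comap (iterateFrobenius (PerfectClosure k p) p n) (PerfectClosure.of k p).fieldRange
  let ιn : k →+* L := (PerfectClosure.of k p).codRestrict L (of_mem_level p k n)
  let Xn := pullback (Spec.map (CommRingCat.ofHom ιn)) f
  let ρ : Rn ⟶ Xn := ρn
  haveI : IsProper ρ := hρnP
  haveI : Surjective ρ := hρnsurj
  have hbir' : IsBirational ρ.toImage := hbir
  haveI : CharP L p := (RingHom.charP_iff_charP L.subtype p).mpr inferInstance
  -- the relative Frobenius `ψ : X → X_n`, factored through the image `S_n` of `ρ`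
  have hpX : (p : Γ(X, ⊤)) = 0 := natCast_appTop_eq_zero p f
  obtain ⟨ψ₀, hψfin, hψui, hψsurj, -⟩ := exists_relFrobenius p f n (add_pow_sections p hpX n)
  let ψ : X ⟶ Xn := ψ₀
  haveI : IsFinite ψ := hψfin
  haveI : UniversallyInjective ψ := hψui
  haveI : Surjective ψ := hψsurj
  let Sn := ρ.image
  let jn : Sn ⟶ Xn := ρ.imageι
  let πn : Rn ⟶ Sn := ρ.toImage
  haveI : Surjective πn := surjective_toImage_of_universallyClosed ρ
  have hker : ρ.ker ≤ ψ.ker := by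
    refine le_trans ?_ (vanishingIdeal_top_le_ker ψ)
    rw [← le_support_iff_le_vanishingIdeal, top_le_iff, ← SetLike.coe_set_eq, Scheme.Hom.support_ker,
      ρ.surjective.range_eq, closure_univ]
    rfl
  let ψ' : X ⟶ Sn := ψ.toImage ≫ inclusion hker
  have hψ' : ψ' ≫ jn = ψ := by
    simp only [ψ', jn, Category.assoc, Scheme.Hom.imageι, inclusion_subschemeι, Scheme.Hom.toImage_imageι]
  haveI : IsFinite (ψ' ≫ jn) := by rw [hψ']; infer_instance
  haveI : IsFinite ψ' := IsFinite.of_comp ψ' jn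
  haveI : UniversallyInjective (ψ' ≫ jn) := by rw [hψ']; infer_instance
  haveI : UniversallyInjective ψ' := universallyInjective_of_comp ψ' jn
  haveI : Surjective ψ' := ⟨fun y => by
    obtain ⟨x, hx⟩ := ψ.surjective (jn.base y)
    exact ⟨x, jn.isClosedEmbedding.injective (by rw [← Scheme.Hom.comp_apply, hψ', hx])⟩⟩
  -- the reduced fibre product `Z = (X ×_{S_n} R_n)_red` and its resolution from (PICover)
  let W := pullback ψ' πn
  let Z := (vanishingIdeal (⊤ : Closeds ↑W)).subscheme
  let ιW : Z ⟶ W := (vanishingIdeal (⊤ : Closeds ↑W)).subschemeι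
  haveI : IsIntegral Z := isIntegral_reduced_pullback ψ' πn
  let fn : Rn ⟶ Spec (.of L) := ρ ≫ pullback.fst _ _
  haveI : IsSeparated fn := inferInstance
  haveI : LocallyOfFiniteType fn := inferInstance
  haveI : QuasiCompact fn := inferInstance
  have hZ : Scheme.HasResolution Z :=
    hPC L Rn Z fn (ιW ≫ pullback.snd ψ' πn) inferInstance inferInstance inferInstance hRnint hRnreg
      inferInstance (isFinite_reduced_pullback_snd ψ' πn)
      (universallyInjective_reduced_pullback_snd ψ' πn) (surjective_reduced_pullback_snd ψ' πn).1
  -- `τ : Z → X` is proper and birational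
  haveI : IsSeparated (ρ.toImage ≫ ρ.imageι) := by rw [Scheme.Hom.toImage_imageι]; infer_instance
  haveI : IsSeparated πn := IsSeparated.of_comp ρ.toImage ρ.imageι
  haveI : LocallyOfFiniteType (ρ.toImage ≫ ρ.imageι) := by
    rw [Scheme.Hom.toImage_imageι]; infer_instance
  haveI : LocallyOfFiniteType πn := locallyOfFiniteType_of_comp ρ.toImage ρ.imageι
  haveI : UniversallyClosed πn := inferInstanceAs (UniversallyClosed ρ.toImage)
  haveI : IsProper πn := ⟨⟩
  let τ : Z ⟶ X := ιW ≫ pullback.fst ψ' πn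
  haveI : IsProper τ := inferInstanceAs (IsProper (ιW ≫ pullback.fst ψ' πn))
  refine Scheme.HasResolution.of_isBirational τ ?_ hZ
  obtain ⟨U, hU, -, hiso⟩ := hbir'
  haveI := hiso
  haveI : Nonempty Sn := ⟨πn.base (Classical.arbitrary Rn)⟩
  let V : X.Opens := ψ' ⁻¹ᵁ U
  obtain ⟨u₀, hu₀⟩ := hU.nonempty
  obtain ⟨x₀, hx₀⟩ := ψ'.surjective u₀
  have hx₀V : x₀ ∈ V := show ψ'.base x₀ ∈ U by rw [hx₀]; exact hu₀
  haveI : Surjective (pullback.fst ψ' πn) := MorphismProperty.pullback_fst _ _ inferInstance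
  haveI : Surjective τ := inferInstance
  refine ⟨V, V.2.dense ⟨x₀, hx₀V⟩, (τ ⁻¹ᵁ V).2.dense ?_, ?_⟩
  · obtain ⟨z, hz⟩ := τ.surjective x₀
    exact ⟨z, show τ.base z ∈ V by rw [hz]; exact hx₀V⟩
  -- over `V` the base change of `πn` is an isomorphism, and so is the reduction
  obtain ⟨sndV, -, SqV⟩ := IsPullback.exists_restrict (IsPullback.of_hasPullback ψ' πn) U
  have hisoU : (MorphismProperty.isomorphisms Scheme) (πn ∣_ U) :=
    (MorphismProperty.isomorphisms.iff _).mpr hiso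
  haveI hfstV : IsIso (pullback.fst ψ' πn ∣_ V) :=
    (MorphismProperty.isomorphisms.iff _).mp
      (MorphismProperty.of_isPullback (P := MorphismProperty.isomorphisms Scheme) SqV.flip hisoU)
  haveI : IsReduced (pullback.fst ψ' πn ⁻¹ᵁ V : Scheme.{0}) :=
    isReduced_of_isOpenImmersion (pullback.fst ψ' πn ∣_ V)
  haveI : IsIso (ιW ∣_ (pullback.fst ψ' πn ⁻¹ᵁ V)) :=
    isIso_subschemeι_vanishingIdeal_top_morphismRestrict _
  rw [show τ ∣_ V = (ιW ∣_ (pullback.fst ψ' πn ⁻¹ᵁ V)) ≫ (pullback.fst ψ' πn ∣_ V) from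
    morphismRestrict_comp _ _ _]
  infer_instance

/-- **The thesis implies the summit, for every ground field** (formerly `PAlteration.Assembly`,
stmt-ResolutionOfSingularities-0553): for every prime `p`, purely inseparable regular alterations
(PIAlt_p) together with resolution of finite radicial covers of regular varieties (PICover_p)
imply resolution of singularities of every reduced separated scheme of finite type over every
field of characteristic `p` — the summit statement `ResolutionOfSingularities`. The hypothesis is
the route decl `PalterationThesis` (by name); the dropped route decl `Assembly` (removed from the
gate-written route file by the multi-assembly lint, 2026-08-16T14:43Z, in favour of `Assembly2`)
was `(body of PalterationThesis, verbatim) → ResolutionOfSingularities`, so this statement is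
definitionally the old one and the old name survives below as a deprecated alias (full-build
repair 2026-08-16; proof unchanged). [folklore] -/
theorem resolutionOfSingularities_of_palterationThesis :
    Summit.ResolutionOfSingularities.ResolutionOfSingularities.Theses.PAlteration.PalterationThesis →
      _root_.ResolutionOfSingularities := by
  intro hT
  refine (_root_.ResolutionOfSingularities_iff).mpr fun p hp => ?_
  haveI : Fact p.Prime := ⟨hp⟩
  obtain ⟨hPI, hPC⟩ := hT p hp
  intro k _ _ X f hsep hlft hqc hred
  exact Summit.ResolutionOfSingularities.ResolutionOfSingularities.Theses.PAlteration.DescentReducedToIntegral_holds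
    k (fun Y g h1 h2 h3 h4 => by
      haveI := h1; haveI := h2; haveI := h3; haveI := h4
      exact hasResolution_of_thesis p hPI hPC g) X f hsep hlft hqc hred

/-- Deprecated name of `resolutionOfSingularities_of_palterationThesis` (it was stated against the
route decl `Theses.PAlteration.Assembly`, stmt-ResolutionOfSingularities-0553, dropped from the route
file 2026-08-16; definitionally the same statement). [folklore] -/
@[deprecated resolutionOfSingularities_of_palterationThesis (since := "2026-08-16")]
alias assembly_proof := resolutionOfSingularities_of_palterationThesis

end Summit.ResolutionOfSingularities.ResolutionOfSingularities.Theorems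

end
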